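/-
Copyright: reproduction cell `pub-balaban` (paper sub-cell B04, gen 7). Mathlib only.
Source under audit: T. Bałaban, *Regularity and decay of lattice Green's functions*, Commun. Math. Phys. 89
(1983) 571–597 — bib key `Balaban1983RegularityDecay` ("B4"). Journal page = PDF page + 570.
-/
import Mathlib

/-!
# B4 (2.12)–(2.13) ⇒ Corollary 2.3 (2.30): the random-walk expansion kernel — locality, walk length, geometric decay

This module is a KERNEL CERTIFICATE OF PRINTED BOOKKEEPING. It types, over an arbitrary (noncommutative) normed
ring, the mechanism by which B4 passes from the Neumann series (2.12) to the "random walk" representation (2.13)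
and from there to the exponential off-diagonal decay of Corollary 2.3 (2.30): finite-range ("local") factors
⇒ only nearest-neighbour walks contribute ⇒ supports at distance `N` are joined only by walks of length `≥ N`
⇒ at most `|S₀|·Dⁿ` walks of length `n` ⇒ a geometric series. Nothing about the actual lattice operators is
asserted (see "What it does NOT prove").

## Text under audit (verbatim, B4)

* p. 577, (2.12): *"so we have the representations (2.12) G_k(Ω,A) = G₀(I − R)^{−1} = Σ_{n=0}^∞ G₀R^n."*, with
  (2.2) (p. 575) *"G₀ = Σ_j h_jG_k(□_j,Ã_j)h_j"* and (2.11) (p. 576) *"R = Σ_j K_j G_k(□_j,Ã_j)h_j."*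
* p. 577, (2.13): *"Let us consider a space of paths ω, each path is a sequence of points ω = {ω₀, ω₁, …, ω_n},
  ω_i ∈ Z^d, satisfying the following condition: the points ω_i, ω_{i+1} are vertices of a unit cube of the
  lattice. It can be formulated also that ω_{i+1} is of the form ω_{i+1} = ω_i + Σ_{μ=1}^{d} ε_μe_μ, where ε_μ is one of the
  numbers −1, 0, 1. We can write (2.13) G_k(Ω,A) = Σ_ω h_{ω₀}G_k(□_{ω₀},Ã_{ω₀})h_{ω₀}K_{ω₁}G_k(□_{ω₁},Ã_{ω₁})h_{ω₁}
  … K_{ω_n}G_k(□_{ω_n},Ã_{ω_n})h_{ω_n}, and this representation follows from (2.12) and the obvious fact that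
  G_k(□_j,Ã_j)h_jK_{j'}G_k(□_{j'},Ã_{j'}) = 0, if |j − j'| = max_μ|j_μ − j'_μ| > 1."*
* p. 577: *"Let us notice that Lemma 2.1 implies that the L²-norm of the operator R given by (2.11) is small for M
  large enough, so the series in the representation (2.12) is convergent in this norm."*
* p. 579, before (2.22): *"The summation in (2.18) is restricted to paths ω satisfying x, x' ∈ □_{ω₀}, supp f ⊂
  □_{ω_n}, so the length n satisfies n ≥ M^{−1}dist({x,x'}, supp f) − 2. There are at most 2^d(3^d)^{n−1}2^d of
  such paths, so finally we get the inequality (2.22) … ≤ Σ_n 2^d c₁(3^d c₂O(1)M^{−1})^n ‖f‖_∞ ≤ …"*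
* pp. 580–581, Corollary 2.3: *"(2.30) |⟨f, G_k(Ω,A)f'⟩|, |⟨f, D^η_{A,μ}G_k(Ω,A)f'⟩|, |⟨f, G_k(Ω,A)D^{η*}_{A,ν}f'⟩|,
  |⟨f, D^η_{A,μ}G_k(Ω,A)D^{η*}_{A,ν}f'⟩| ≤ c₀e^{−δ₀dist(supp f, supp f')}‖f‖₂‖f'‖₂."* … *"Of course it is enough
  to prove it for f, f' with supports in unit cubes, and the proof proceeds as before using only the L²-bounds
  of Lemma 2.1."*

## Dictionary (abstract ↦ B4)

* `R` a normed ring ↦ bounded operators on `L²(Ω)` (η-lattice); `ι` a finite index type ↦ the centres `j ∈ ℤ^d`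
  of the cubes `□_j` meeting `Ω`; `pos : ι → ℤ^d` ↦ `j ↦ j`; `cubeAdj pos j j'` ↦ `|j − j'| = max_μ|j_μ − j'_μ| ≤ 1`.
* `a j` ↦ `h_jG_k(□_j,Ã_j)h_j` (so `G₀ = Σ_j a j`, (2.2)); `b j` ↦ `K_jG_k(□_j,Ã_j)h_j` (so `Rop = Σ_j b j`,
  (2.11)); the printed path term of (2.13) for `ω = (ω₀, …, ω_n)` is `a ω₀ * b ω₁ * ⋯ * b ω_n`
  = `a ω₀ * bprod b n (ω₁,…,ω_n)`.
* LOCALITY `¬ cubeAdj j j' → a j * b j' = 0 ∧ b j * b j' = 0` ↦ the *"obvious fact"* of p. 577 (the factor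
  `G_k(□_j,Ã_j)h_jK_{j'}G_k(□_{j'},Ã_{j'})` sits inside both products).
* `P`, `P'` ↦ left/right support cut-offs: `P = ⟨f, ·⟩`-side restriction (possibly composed with `D^η_{A,μ}`),
  `P' = ·f'`-side restriction (possibly composed with `D^{η*}_{A,ν}`); `S₀` ↦ the (at most `2^d`) cubes `□_{ω₀}`
  whose `h_{ω₀}` meets `supp f`; `S₁` ↦ those meeting `supp f'`; `P * a j = 0 (j ∉ S₀)`, `a j * P' = 0`,
  `b j * P' = 0 (j ∉ S₁)` ↦ disjointness of supports.
* `α ≥ ‖P * a j‖`, `β ≥ ‖b j‖`, `β₁ ≥ ‖b j * P'‖` ↦ the L²-bounds supplied by Lemma 2.1 (2.15) together with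
  `|∂^ηh_j| ≤ O(M^{−1})`, `|Δ^ηh_j| ≤ O(M^{−2})` (so `β = c₂O(1)M^{−1}`); `D = 3^d` ↦ the number of successors of a
  path point; `N` ↦ the least number of steps from `S₀` to `S₁`, `N ≥ M^{−1}dist(supp f, supp f') − 2`.

## What this module proves (all elementary; every `theorem` below is proved in full)

* §1–§3 (pure ring algebra and finite sums, any ring): the expansion
  `(Σ_j a j)(Σ_j b j)ⁿ = Σ_{ω₀} Σ_{(ω₁…ω_n)} a ω₀ * Π b ω_i` over ALL index tuples (`sum_pow_eq_sum_bprod`,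
  `order_term_eq_sum_tuples`) and — the content of (2.13) — that under LOCALITY every non-walk tuple contributes
  `0`, so the order-`n` term of (2.12) equals the sum over nearest-neighbour walks
  (`mul_bprod_eq_zero_of_not_isWalk`, `order_term_eq_sum_walks`), with the support cut-offs `P`, `P'` carried
  along (`cut_order_term_eq`, `cut_order_term_eq_zero`: terms of order `n < N` vanish when `S₀` and `S₁` are `N`
  steps apart); the algebra (2.11) ⇒ `G(I − R) = G₀` (`G_mul_one_sub_eq`); and COUNTING: out-degree `≤ D` ⇒ at
  most `Dⁿ` walks of length `n` from a point (`card_walks_le`) — the printed *"at most 2^d(3^d)^{n−1}2^d of such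
  paths"* in the start-anchored form `|S₀|·(3^d)ⁿ`.
* §4 (normed ring): `‖P * G * P'‖ ≤ |S₀|·α·β₁·D·(Dβ)^{N−1}/(1 − Dβ)` whenever `G = Σ_n G₀Rⁿ` (as a `HasSum`),
  locality, cut-offs, the three norm bounds, out-degree `≤ D`, `Dβ < 1` and `N ≥ 1` steps of separation hold
  (`walk_decay_bound`) — the shape of (2.22)/(2.30): geometric decay in the number of steps between the supports;
  and the Neumann-series facts behind (2.12) in a complete normed ring: `‖R‖ < 1 ∧ G(I − R) = G₀ ⇒ G = Σ_n G₀Rⁿ`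
  (`hasSum_of_norm_lt_one`).
* §5 (the `ℤ^d` model): for `cubeAdj` (sup-distance `≤ 1` between distinct lattice labels) the out-degree is
  `≤ 3^d` (`card_cubeAdj_le`), a walk of length `n` moves each coordinate by at most `n` (`walk_displacement`),
  hence supports at sup-distance `≥ N` need `≥ N` steps (`le_length_of_separated`), and the specialisation of §4
  with `D = 3^d` (`lattice_walk_decay_bound`).
* §6 (inner-product space): the bounded-overlap (Schur-test) inequality `‖Σ_j u j‖² ≤ m·Σ_j‖u j‖²` for vectors
  orthogonal off a symmetric relation of degree `≤ m` (`norm_sum_sq_le_of_overlap`) and the covering count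
  `Σ_j Σ_x χ_j(x)c(x) ≤ m̃ Σ_x c(x)` (`sum_overlap_le`) — the two elementary steps by which a bound on ONE summand
  `K_jG_k(□_j,Ã_j)h_j` (Lemma 2.1 × `O(M^{−1})`) controls `‖R‖` uniformly in the number of cubes, i.e. in `|Ω|`
  (p. 577, *"the L²-norm of the operator R … is small for M large enough"*).

## What it does NOT prove (prose only; cell records GAPS.md C-b04g7-1, DIVERGENCE.md D-b04g7-1)

* the operators themselves (`G_k(□_j,Ã_j)`, `K_j`, `h_j`, `D^η_A`), the parametrix identity (2.9)–(2.11), the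
  bounds of Lemma 2.1 (2.15) and the smallness *"L²-norm of R … small for M large"* — these enter §4 only as the
  HYPOTHESES `hG`, `hab/hbb`, `hα/hβ/hβ₁`, `hDβ`; in particular the convergence of (2.12) is an input (`HasSum`),
  not an output, exactly as on p. 577;
* the identification `N ≥ M^{−1}dist(supp f, supp f') − 2` between lattice distance and number of `M`-cube steps,
  and the final constants `c₀, δ₀` of (2.30) (here: `|S₀|αβ₁D(Dβ)^{N−1}(1 − Dβ)^{−1}`, resp. `Dβ ≤ e^{−δ}` gives
  `e^{−δ(N−1)}`, `walk_decay_bound_exp`);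
* the `δG_k(Ω,Ω₀,A)` clause of Corollary 2.3 and the `L^p → L^q` version (2.18)–(2.21) of Lemma 2.2;
* in §6, the identification `u j = K_jG_k(□_j,Ã_j)h_jf`, the orthogonality of non-overlapping summands and the
  overlap numbers `m, m̃ ≤ 3^d` are dictionary, not typed.

## References (source-labelled)

* Neumann series / geometric series in a complete normed ring: Mathlib `summable_geometric_of_norm_lt_one`,
  `mul_neg_geom_series`, `hasSum_geometric_of_lt_one`, `HasSum.norm_le_of_bounded` [folklore];
* related typed walk calculi in this directory (block-majorant DECAY sums, a different mechanism):
  `B6RandomWalk` (B6 (2.62)), `B5Walk131`; the present file types the operator identity (2.13) from LOCALITY and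
  the walk-LENGTH mechanism of (2.22)/(2.30), which those do not;
* every theorem below is elementary finite algebra / counting / a geometric series, proved in full here; nothing
  is cited as a hypothesis, and the manuscript under audit is quoted, never invoked.

Version log: v1 — 2026-08-19, planner-b2b-balaban-b04-g7-0 (p181581). v1.1 (this file) — 2026-08-19,
planner-b2b-balaban-b04-g8-0: DOCSTRING-ONLY fix after the cross-read XREAD C-B11-G8b (b2b-balaban-b11-g8): the
display number of `G₀ = Σ_j h_jG_k(□_j,Ã_j)h_j` is (2.2), p. 575 (the printed (2.3) is the Leibniz rule for `D^η_A(hφ)`)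
— corrected at both places (N1); page of (2.11) = p. 576 added (R1); the printed summation limits `Σ_{μ=1}^{d}` in
the (2.13) sentence restored (R2). Every declaration (names, signatures, proofs) is byte-identical to v1.
-/

namespace Literature.MathematicalPhysics.QuantumFieldTheory.Balaban1983to89.B4RandomWalk213

open Finset

/-! ### §1 Index tuples: ordered products, end-points, nearest-neighbour walks -/

section Tuples

variable {R : Type*} [Ring R] {ι : Type*}

/-- the ORDERED product `b(ys 0) * b(ys 1) * ⋯ * b(ys (n−1))` along an index tuple (the ring is not assumed
commutative: these are the operator factors `K_{ω₁}G_k(□_{ω₁})h_{ω₁} ⋯ K_{ω_n}G_k(□_{ω_n})h_{ω_n}` of (2.13)).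
[cite: Balaban1983RegularityDecay, (2.13) p.577] -/
def bprod (b : ι → R) : (n : ℕ) → (Fin n → ι) → R
  | 0, _ => 1
  | n + 1, ys => b (ys 0) * bprod b n (Fin.tail ys)

/-- the empty ordered product is `1`. [folklore] -/
@[simp] theorem bprod_zero (b : ι → R) (ys : Fin 0 → ι) : bprod b 0 ys = 1 := rfl

/-- peel off the first factor. [folklore] -/
theorem bprod_succ (b : ι → R) (n : ℕ) (ys : Fin (n + 1) → ι) :
    bprod b (n + 1) ys = b (ys 0) * bprod b n (Fin.tail ys) := rfl

/-- the ordered product along `(i, ys)`. [folklore] -/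
@[simp] theorem bprod_cons (b : ι → R) (n : ℕ) (i : ι) (ys : Fin n → ι) :
    bprod b (n + 1) (Fin.cons i ys) = b i * bprod b n ys := by
  rw [bprod_succ, Fin.cons_zero, Fin.tail_cons]

/-- a one-step product is the single factor. [folklore] -/
theorem bprod_one (b : ι → R) (ys : Fin 1 → ι) : bprod b 1 ys = b (ys 0) := by
  rw [bprod_succ, bprod_zero, mul_one]

/-- the END-POINT `ω_n` of the path `(j, ys 0, …, ys (n−1))` (`= j` for the path of length `0`).
[cite: Balaban1983RegularityDecay, (2.13) p.577, "supp f ⊂ □_{ω_n}" p.579] -/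
def lastPt (j : ι) : (n : ℕ) → (Fin n → ι) → ι
  | 0, _ => j
  | n + 1, ys => ys (Fin.last n)

/-- the end-point of the trivial path. [folklore] -/
@[simp] theorem lastPt_zero (j : ι) (ys : Fin 0 → ι) : lastPt j 0 ys = j := rfl

/-- the end-point of a path of positive length is the last entry of the tuple. [folklore] -/
theorem lastPt_succ (j : ι) (n : ℕ) (ys : Fin (n + 1) → ι) : lastPt j (n + 1) ys = ys (Fin.last n) := rfl

/-- the end-point is unchanged when the path is read from its second point. [folklore] -/
theorem lastPt_tail (j : ι) : ∀ (n : ℕ) (ys : Fin (n + 1) → ι),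
    lastPt (ys 0) n (Fin.tail ys) = lastPt j (n + 1) ys
  | 0, ys => by rw [lastPt_zero, lastPt_succ, Fin.last_zero]
  | _ + 1, _ => rfl

/-- the end-point of `(j, i, ys)` is the end-point of `(i, ys)`. [folklore] -/
theorem lastPt_cons (j i : ι) (n : ℕ) (ys : Fin n → ι) :
    lastPt j (n + 1) (Fin.cons i ys : Fin (n + 1) → ι) = lastPt i n ys := by
  rw [← lastPt_tail, Fin.cons_zero, Fin.tail_cons]

/-- the WALK CONDITION of (2.13): consecutive points of `(j, ys 0, …, ys (n−1))` are adjacent — *"the points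
ω_i, ω_{i+1} are vertices of a unit cube of the lattice"*, here for an arbitrary adjacency relation `adj`.
[cite: Balaban1983RegularityDecay, (2.13) p.577] -/
def IsWalk (adj : ι → ι → Prop) (j : ι) {n : ℕ} (ys : Fin n → ι) : Prop :=
  ∀ k : Fin n, adj ((Fin.cons j ys : Fin (n + 1) → ι) (Fin.castSucc k)) (ys k)

/-- the walk condition is decidable for a decidable adjacency (walks form a `Finset`). [folklore] -/
instance IsWalk.instDecidable (adj : ι → ι → Prop) [DecidableRel adj] (j : ι) {n : ℕ} (ys : Fin n → ι) :
    Decidable (IsWalk adj j ys) :=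
  inferInstanceAs (Decidable (∀ k : Fin n, adj ((Fin.cons j ys : Fin (n + 1) → ι) (Fin.castSucc k)) (ys k)))

/-- the path of length `0` is a walk. [folklore] -/
@[simp] theorem isWalk_zero (adj : ι → ι → Prop) (j : ι) (ys : Fin 0 → ι) : IsWalk adj j ys :=
  fun k => k.elim0

/-- walk recursion: `(j, i, ys)` is a walk iff `j ~ i` and `(i, ys)` is a walk. [folklore] -/
theorem isWalk_cons {adj : ι → ι → Prop} {j i : ι} {n : ℕ} {ys : Fin n → ι} :
    IsWalk adj j (Fin.cons i ys : Fin (n + 1) → ι) ↔ adj j i ∧ IsWalk adj i ys := by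
  unfold IsWalk
  rw [Fin.forall_fin_succ]
  have h0 : (Fin.cons j (Fin.cons i ys : Fin (n + 1) → ι) : Fin (n + 2) → ι) (Fin.castSucc 0) = j := by
    simp
  have h0' : (Fin.cons i ys : Fin (n + 1) → ι) 0 = i := by simp
  have h1 : ∀ k : Fin n, (Fin.cons j (Fin.cons i ys : Fin (n + 1) → ι) : Fin (n + 2) → ι)
      (Fin.castSucc (Fin.succ k)) = (Fin.cons i ys : Fin (n + 1) → ι) (Fin.castSucc k) := fun k => by
    rw [← Fin.succ_castSucc, Fin.cons_succ]
  have h2 : ∀ k : Fin n, (Fin.cons i ys : Fin (n + 1) → ι) (Fin.succ k) = ys k := fun k => by simp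
  simp only [h0, h0', h1, h2]

/-- walk recursion for a general tuple: `(j, ys)` is a walk iff `j ~ ys 0` and `(ys 0, tail ys)` is a walk.
[folklore] -/
theorem isWalk_succ {adj : ι → ι → Prop} {j : ι} {n : ℕ} {ys : Fin (n + 1) → ι} :
    IsWalk adj j ys ↔ adj j (ys 0) ∧ IsWalk adj (ys 0) (Fin.tail ys) := by
  rw [← isWalk_cons (adj := adj) (j := j), Fin.cons_self_tail]

/-! ### §2 Locality ⇒ only walks contribute ((2.12) ⇒ (2.13)); support cut-offs -/

/-- **LOCALITY KILLS NON-WALKS** (the mechanism of (2.13)): if `b i * b l = 0` whenever `i ≁ l`, and the left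
factor `x` satisfies `x * b l = 0` whenever `j ≁ l`, then `x * b(ys 0) * ⋯ * b(ys (n−1)) = 0` for every tuple
`(j, ys)` that is NOT a walk. [cite: Balaban1983RegularityDecay, (2.13) p.577 "obvious fact"] -/
theorem mul_bprod_eq_zero_of_not_isWalk {adj : ι → ι → Prop} {b : ι → R}
    (hbb : ∀ i l, ¬ adj i l → b i * b l = 0) :
    ∀ (n : ℕ) {j : ι} {x : R}, (∀ l, ¬ adj j l → x * b l = 0) → ∀ {ys : Fin n → ι},
      ¬ IsWalk adj j ys → x * bprod b n ys = 0 := by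
  intro n
  induction n with
  | zero => intro j x _ ys h; exact (h (isWalk_zero adj j ys)).elim
  | succ n ih =>
      intro j x hx ys h
      rw [isWalk_succ] at h
      rw [bprod_succ, ← mul_assoc]
      by_cases h0 : adj j (ys 0)
      · exact ih (fun l hl => by rw [mul_assoc, hbb _ _ hl, mul_zero]) fun hw => h ⟨h0, hw⟩
      · rw [hx _ h0, zero_mul]

/-- **RIGHT CUT-OFF**: if the last factor is killed by `P'` (`b (ω_n) * P' = 0`), the whole path term is.
[cite: Balaban1983RegularityDecay, p.579 "supp f ⊂ □_{ω_n}"] -/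
theorem mul_bprod_mul_eq_zero_of_last (b : ι → R) {P' : R} :
    ∀ (n : ℕ) (x : R) (ys : Fin (n + 1) → ι), b (ys (Fin.last n)) * P' = 0 →
      x * bprod b (n + 1) ys * P' = 0 := by
  intro n
  induction n with
  | zero =>
      intro x ys h
      have h' : b (ys 0) * P' = 0 := by simpa using h
      rw [bprod_one, mul_assoc, h', mul_zero]
  | succ n ih =>
      intro x ys h
      rw [bprod_succ, ← mul_assoc x]
      exact ih (x * b (ys 0)) (Fin.tail ys) h

/-- (2.11) ⇒ the first equality of (2.12), as pure algebra: if `G` is a left inverse-partner of `H`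
(`G * H = 1`) and `H * G₀ = 1 − R` (this is (2.9)–(2.11): `(−Δ + m² + P)G₀ = I − R`), then `G(I − R) = G₀`.
[cite: Balaban1983RegularityDecay, (2.9)–(2.12) pp.576–577] -/
theorem G_mul_one_sub_eq {G H G₀ Rop : R} (hGH : G * H = 1) (h211 : H * G₀ = 1 - Rop) :
    G * (1 - Rop) = G₀ := by
  rw [← h211, ← mul_assoc, hGH, one_mul]

end Tuples

/-! ### §3 The order-`n` term of (2.12) as a sum over tuples and over walks; counting walks -/

section Sums

variable {R : Type*} [Ring R] {ι : Type*} [Fintype ι]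

/-- Fubini for tuples: split off the first entry. [folklore] -/
theorem sum_tuple_succ {M : Type*} [AddCommMonoid M] (n : ℕ) (F : (Fin (n + 1) → ι) → M) :
    ∑ zs : Fin (n + 1) → ι, F zs = ∑ i, ∑ ys : Fin n → ι, F (Fin.cons i ys) := by
  rw [← Fintype.sum_equiv (Fin.consEquiv fun _ : Fin (n + 1) => ι)
      (fun p : ι × (Fin n → ι) => F (Fin.cons p.1 p.2)) F (fun _ => rfl),
    Fintype.sum_prod_type]

/-- **`Rⁿ` OVER TUPLES**: `(Σ_j b j)ⁿ = Σ_{(ω₁,…,ω_n)} b ω₁ ⋯ b ω_n` (noncommutative multinomial expansion).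
[folklore] -/
theorem sum_pow_eq_sum_bprod (b : ι → R) : ∀ n : ℕ, (∑ i, b i) ^ n = ∑ ys : Fin n → ι, bprod b n ys
  | 0 => by simp
  | n + 1 => by
      rw [pow_succ', sum_pow_eq_sum_bprod b n, Finset.sum_mul_sum, sum_tuple_succ]
      simp only [bprod_cons]

/-- **THE ORDER-`n` TERM OF (2.12) OVER ALL TUPLES**: `G₀Rⁿ = Σ_{ω₀} Σ_{(ω₁…ω_n)} a ω₀ * b ω₁ ⋯ b ω_n`.
[cite: Balaban1983RegularityDecay, (2.12) p.577] -/
theorem order_term_eq_sum_tuples (a b : ι → R) (n : ℕ) :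
    (∑ i, a i) * (∑ i, b i) ^ n = ∑ i, ∑ ys : Fin n → ι, a i * bprod b n ys := by
  rw [sum_pow_eq_sum_bprod, Finset.sum_mul_sum]

/-- the finite set of walks `(ω₁, …, ω_n)` of length `n` issuing from `j = ω₀`.
[cite: Balaban1983RegularityDecay, (2.13) p.577] -/
def walks (adj : ι → ι → Prop) [DecidableRel adj] (j : ι) (n : ℕ) : Finset (Fin n → ι) :=
  Finset.univ.filter fun ys => IsWalk adj j ys

/-- membership in `walks`. [folklore] -/
@[simp] theorem mem_walks {adj : ι → ι → Prop} [DecidableRel adj] {j : ι} {n : ℕ} {ys : Fin n → ι} :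
    ys ∈ walks adj j n ↔ IsWalk adj j ys := by
  simp [walks]

/-- **(2.13) AT ORDER `n`**: under LOCALITY (`a i * b l = 0` and `b i * b l = 0` for `i ≁ l`) the order-`n` term
of the Neumann series is the sum over nearest-neighbour WALKS only:
`G₀Rⁿ = Σ_{ω walk, |ω| = n} a ω₀ * b ω₁ ⋯ b ω_n`. [cite: Balaban1983RegularityDecay, (2.12)–(2.13) p.577] -/
theorem order_term_eq_sum_walks (adj : ι → ι → Prop) [DecidableRel adj] {a b : ι → R}
    (hab : ∀ i l, ¬ adj i l → a i * b l = 0) (hbb : ∀ i l, ¬ adj i l → b i * b l = 0) (n : ℕ) :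
    (∑ i, a i) * (∑ i, b i) ^ n = ∑ i, ∑ ys ∈ walks adj i n, a i * bprod b n ys := by
  rw [order_term_eq_sum_tuples]
  refine Finset.sum_congr rfl fun i _ => (Finset.sum_filter_of_ne fun ys _ hne => ?_).symm
  by_contra hw
  exact hne (mul_bprod_eq_zero_of_not_isWalk hbb n (fun l hl => hab i l hl) hw)

/-- (2.13) with the support cut-offs carried along:
`P * G₀Rⁿ * P' = Σ_{ω₀} Σ_{walks} P * a ω₀ * b ω₁ ⋯ b ω_n * P'`. [cite: Balaban1983RegularityDecay, (2.13) p.577,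
(2.18) p.578] -/
theorem cut_order_term_eq (adj : ι → ι → Prop) [DecidableRel adj] {a b : ι → R}
    (hab : ∀ i l, ¬ adj i l → a i * b l = 0) (hbb : ∀ i l, ¬ adj i l → b i * b l = 0) (P P' : R) (n : ℕ) :
    P * ((∑ i, a i) * (∑ i, b i) ^ n) * P' = ∑ i, ∑ ys ∈ walks adj i n, P * a i * bprod b n ys * P' := by
  rw [order_term_eq_sum_walks adj hab hbb, Finset.mul_sum, Finset.sum_mul]
  refine Finset.sum_congr rfl fun i _ => ?_
  rw [Finset.mul_sum, Finset.sum_mul]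
  refine Finset.sum_congr rfl fun ys _ => ?_
  simp only [mul_assoc]

/-- **TERMS OF ORDER `n < N` VANISH** when every walk from `S₀` ending in `S₁` has length `≥ N`
(`P` kills `a i` off `S₀`; `P'` kills `a i`, `b i` off `S₁`): the printed restriction *"the length n satisfies
n ≥ M^{−1}dist({x,x'}, supp f) − 2"*. [cite: Balaban1983RegularityDecay, p.579 before (2.22)] -/
theorem cut_order_term_eq_zero (adj : ι → ι → Prop) [DecidableRel adj] {a b : ι → R} {P P' : R}
    {S₀ S₁ : Finset ι} {N n : ℕ}
    (hab : ∀ i l, ¬ adj i l → a i * b l = 0) (hbb : ∀ i l, ¬ adj i l → b i * b l = 0)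
    (hP : ∀ i ∉ S₀, P * a i = 0) (hP'a : ∀ i ∉ S₁, a i * P' = 0) (hP'b : ∀ i ∉ S₁, b i * P' = 0)
    (hsep : ∀ (n : ℕ) (i : ι), i ∈ S₀ → ∀ ys : Fin n → ι, IsWalk adj i ys → lastPt i n ys ∈ S₁ → N ≤ n)
    (hn : n < N) :
    P * ((∑ i, a i) * (∑ i, b i) ^ n) * P' = 0 := by
  rw [cut_order_term_eq adj hab hbb P P' n]
  refine Finset.sum_eq_zero fun i _ => Finset.sum_eq_zero fun ys hys => ?_
  by_cases hi : i ∈ S₀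
  · by_cases hl : lastPt i n ys ∈ S₁
    · exact absurd (hsep n i hi ys (mem_walks.mp hys) hl) (not_le.mpr hn)
    · cases n with
      | zero =>
          rw [lastPt_zero] at hl
          rw [bprod_zero, mul_one, mul_assoc, hP'a i hl, mul_zero]
      | succ m => exact mul_bprod_mul_eq_zero_of_last b m (P * a i) ys (hP'b _ hl)
  · rw [hP i hi, zero_mul, zero_mul]

variable [DecidableEq ι]

/-- a walk of length `n + 1` from `j` is a neighbour `i ~ j` followed by a walk of length `n` from `i`.
[folklore] -/
theorem walks_succ_subset (adj : ι → ι → Prop) [DecidableRel adj] (j : ι) (n : ℕ) :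
    walks adj j (n + 1) ⊆
      (Finset.univ.filter fun i => adj j i).biUnion fun i =>
        (walks adj i n).image fun ys : Fin n → ι => (Fin.cons i ys : Fin (n + 1) → ι) := by
  intro zs hz
  rw [mem_walks, isWalk_succ] at hz
  rw [Finset.mem_biUnion]
  refine ⟨zs 0, Finset.mem_filter.mpr ⟨Finset.mem_univ _, hz.1⟩, Finset.mem_image.mpr ?_⟩
  exact ⟨Fin.tail zs, mem_walks.mpr hz.2, Fin.cons_self_tail zs⟩

/-- **COUNTING WALKS**: if every point has at most `D` neighbours, there are at most `Dⁿ` walks of length `n` from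
a given point — with `D = 3^d` this is the printed *"at most 2^d(3^d)^{n−1}2^d of such paths"* (start-anchored:
`|S₀|·(3^d)ⁿ`). [cite: Balaban1983RegularityDecay, p.579 before (2.22)] -/
theorem card_walks_le (adj : ι → ι → Prop) [DecidableRel adj] {D : ℕ}
    (hD : ∀ j, (Finset.univ.filter fun i => adj j i).card ≤ D) :
    ∀ (n : ℕ) (j : ι), (walks adj j n).card ≤ D ^ n := by
  intro n
  induction n with
  | zero =>
      intro j
      rw [pow_zero]
      exact (Finset.card_le_univ _).trans (by simp)
  | succ n ih =>
      intro j
      calc (walks adj j (n + 1)).card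
          ≤ ((Finset.univ.filter fun i => adj j i).biUnion fun i =>
              (walks adj i n).image fun ys : Fin n → ι => (Fin.cons i ys : Fin (n + 1) → ι)).card :=
            Finset.card_le_card (walks_succ_subset adj j n)
        _ ≤ ∑ i ∈ Finset.univ.filter (fun i => adj j i),
              ((walks adj i n).image fun ys : Fin n → ι => (Fin.cons i ys : Fin (n + 1) → ι)).card :=
            Finset.card_biUnion_le
        _ ≤ ∑ i ∈ Finset.univ.filter (fun i => adj j i), D ^ n :=
            Finset.sum_le_sum fun i _ => Finset.card_image_le.trans (ih i)
        _ ≤ D * D ^ n := by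
            rw [Finset.sum_const, smul_eq_mul]
            exact Nat.mul_le_mul_right _ (hD j)
        _ = D ^ (n + 1) := (pow_succ' D n).symm

end Sums

/-! ### §4 Normed ring: path-term bounds, the geometric series, the decay bound of (2.22)/(2.30) -/

section Normed

variable {R : Type*} [NormedRing R] {ι : Type*}

/-- `‖x * b ω₁ ⋯ b ω_n‖ ≤ ‖x‖βⁿ` if `‖b j‖ ≤ β`. [folklore] -/
theorem norm_mul_bprod_le {b : ι → R} {β : ℝ} (hβ : ∀ i, ‖b i‖ ≤ β) :
    ∀ (n : ℕ) (x : R) (ys : Fin n → ι), ‖x * bprod b n ys‖ ≤ ‖x‖ * β ^ n := by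
  intro n
  induction n with
  | zero => intro x ys; simp
  | succ n ih =>
      intro x ys
      have hβ0 : 0 ≤ β := (norm_nonneg _).trans (hβ (ys 0))
      rw [bprod_succ, ← mul_assoc, pow_succ', ← mul_assoc]
      calc ‖x * b (ys 0) * bprod b n (Fin.tail ys)‖ ≤ ‖x * b (ys 0)‖ * β ^ n := ih _ _
        _ ≤ ‖x‖ * β * β ^ n :=
            mul_le_mul_of_nonneg_right
              ((norm_mul_le _ _).trans (mul_le_mul_of_nonneg_left (hβ _) (norm_nonneg _)))
              (pow_nonneg hβ0 n)

/-- `‖x * b ω₁ ⋯ b ω_{n+1} * P'‖ ≤ ‖x‖βⁿβ₁` if `‖b j‖ ≤ β` and `‖b j * P'‖ ≤ β₁` (the printed product of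
operator norms along the path, (2.20)–(2.21), in its L² form). [cite: Balaban1983RegularityDecay, (2.20)–(2.21)
p.578, p.581 "using only the L²-bounds of Lemma 2.1"] -/
theorem norm_mul_bprod_mul_le {b : ι → R} {P' : R} {β β₁ : ℝ} (hβ : ∀ i, ‖b i‖ ≤ β)
    (hβ₁ : ∀ i, ‖b i * P'‖ ≤ β₁) :
    ∀ (n : ℕ) (x : R) (ys : Fin (n + 1) → ι), ‖x * bprod b (n + 1) ys * P'‖ ≤ ‖x‖ * β ^ n * β₁ := by
  intro n
  induction n with
  | zero =>
      intro x ys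
      rw [bprod_one, mul_assoc, pow_zero, mul_one]
      exact (norm_mul_le _ _).trans (mul_le_mul_of_nonneg_left (hβ₁ _) (norm_nonneg _))
  | succ n ih =>
      intro x ys
      have hβ0 : 0 ≤ β := (norm_nonneg _).trans (hβ (ys 0))
      have hβ₁0 : 0 ≤ β₁ := (norm_nonneg _).trans (hβ₁ (ys 0))
      have hx : ‖x * b (ys 0)‖ ≤ ‖x‖ * β :=
        (norm_mul_le _ _).trans (mul_le_mul_of_nonneg_left (hβ _) (norm_nonneg _))
      rw [bprod_succ, ← mul_assoc x]
      calc ‖x * b (ys 0) * bprod b (n + 1) (Fin.tail ys) * P'‖ ≤ ‖x * b (ys 0)‖ * β ^ n * β₁ := ih _ _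
        _ ≤ ‖x‖ * β * β ^ n * β₁ :=
            mul_le_mul_of_nonneg_right (mul_le_mul_of_nonneg_right hx (pow_nonneg hβ0 n)) hβ₁0
        _ = ‖x‖ * β ^ (n + 1) * β₁ := by ring

variable [Fintype ι] [DecidableEq ι]

/-- **NORM OF THE ORDER-`(m+1)` TERM**: `‖P * G₀R^{m+1} * P'‖ ≤ |S₀|·D^{m+1}·αβ^mβ₁` — the number of walks from
`S₀` times the product of the norm bounds along a walk ((2.22), one summand).
[cite: Balaban1983RegularityDecay, (2.22) p.579] -/
theorem norm_cut_order_term_le (adj : ι → ι → Prop) [DecidableRel adj] {a b : ι → R} {P P' : R}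
    {S₀ : Finset ι} {α β β₁ : ℝ} {D : ℕ}
    (hab : ∀ i l, ¬ adj i l → a i * b l = 0) (hbb : ∀ i l, ¬ adj i l → b i * b l = 0)
    (hP : ∀ i ∉ S₀, P * a i = 0)
    (hα : ∀ i, ‖P * a i‖ ≤ α) (hβ : ∀ i, ‖b i‖ ≤ β) (hβ₁ : ∀ i, ‖b i * P'‖ ≤ β₁)
    (hD : ∀ j, (Finset.univ.filter fun i => adj j i).card ≤ D) (m : ℕ) :
    ‖P * ((∑ i, a i) * (∑ i, b i) ^ (m + 1)) * P'‖ ≤ S₀.card * (D : ℝ) ^ (m + 1) * (α * β ^ m * β₁) := by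
  rw [cut_order_term_eq adj hab hbb P P' (m + 1)]
  have hterm : ∀ i, ∀ ys : Fin (m + 1) → ι, ‖P * a i * bprod b (m + 1) ys * P'‖ ≤ α * β ^ m * β₁ :=
    fun i ys => by
      have hβ0 : 0 ≤ β := (norm_nonneg _).trans (hβ (ys 0))
      have hβ₁0 : 0 ≤ β₁ := (norm_nonneg _).trans (hβ₁ (ys 0))
      exact (norm_mul_bprod_mul_le hβ hβ₁ m (P * a i) ys).trans
        (mul_le_mul_of_nonneg_right (mul_le_mul_of_nonneg_right (hα i) (pow_nonneg hβ0 m)) hβ₁0)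
  have hvan : ∀ i ∉ S₀, ∑ ys ∈ walks adj i (m + 1), ‖P * a i * bprod b (m + 1) ys * P'‖ = 0 :=
    fun i hi => Finset.sum_eq_zero fun ys _ => by rw [hP i hi, zero_mul, zero_mul, norm_zero]
  have hnn : ∀ i : ι, 0 ≤ α * β ^ m * β₁ := fun i =>
    mul_nonneg (mul_nonneg ((norm_nonneg _).trans (hα i)) (pow_nonneg ((norm_nonneg _).trans (hβ i)) m))
      ((norm_nonneg _).trans (hβ₁ i))
  calc ‖∑ i, ∑ ys ∈ walks adj i (m + 1), P * a i * bprod b (m + 1) ys * P'‖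
      ≤ ∑ i, ‖∑ ys ∈ walks adj i (m + 1), P * a i * bprod b (m + 1) ys * P'‖ := norm_sum_le _ _
    _ ≤ ∑ i, ∑ ys ∈ walks adj i (m + 1), ‖P * a i * bprod b (m + 1) ys * P'‖ :=
        Finset.sum_le_sum fun i _ => norm_sum_le _ _
    _ = ∑ i ∈ S₀, ∑ ys ∈ walks adj i (m + 1), ‖P * a i * bprod b (m + 1) ys * P'‖ :=
        (Finset.sum_subset (Finset.subset_univ S₀) fun i _ hi => hvan i hi).symm
    _ ≤ ∑ i ∈ S₀, ∑ _ys ∈ walks adj i (m + 1), α * β ^ m * β₁ :=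
        Finset.sum_le_sum fun i _ => Finset.sum_le_sum fun ys _ => hterm i ys
    _ ≤ ∑ _i ∈ S₀, (D : ℝ) ^ (m + 1) * (α * β ^ m * β₁) := by
        refine Finset.sum_le_sum fun i _ => ?_
        rw [Finset.sum_const, nsmul_eq_mul]
        exact mul_le_mul_of_nonneg_right (by exact_mod_cast card_walks_le adj hD (m + 1) i) (hnn i)
    _ = S₀.card * (D : ℝ) ^ (m + 1) * (α * β ^ m * β₁) := by
        rw [Finset.sum_const, nsmul_eq_mul]
        ring

/-- **THE DECAY BOUND OF (2.22)/(2.30), ABSTRACT FORM.** Let `G = Σ_n G₀Rⁿ` ((2.12), as a convergent series in a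
normed ring), `G₀ = Σ_j a j`, `R = Σ_j b j` with LOCAL factors (`a j b j' = 0 = b j b j'` unless `j ~ j'`), let
`P`, `P'` be cut-offs killing `a j` off `S₀` on the left and `a j`, `b j` off `S₁` on the right, with
`‖P a j‖ ≤ α`, `‖b j‖ ≤ β`, `‖b j P'‖ ≤ β₁`, out-degree of `~` at most `D`, `Dβ < 1`, and suppose every walk from
`S₀` ending in `S₁` has at least `N ≥ 1` steps. Then
`‖P G P'‖ ≤ |S₀| · α · β₁ · D · (Dβ)^{N−1} / (1 − Dβ)`:
*"≤ Σ_n 2^d c₁(3^d c₂O(1)M^{−1})^n"* summed over `n ≥ N`. [cite: Balaban1983RegularityDecay, (2.22) p.579,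
Corollary 2.3 (2.30) pp.580–581] -/
theorem walk_decay_bound (adj : ι → ι → Prop) [DecidableRel adj]
    {a b : ι → R} {G G₀ Rop P P' : R} {S₀ S₁ : Finset ι} {α β β₁ : ℝ} {D N : ℕ}
    (hG₀ : G₀ = ∑ i, a i) (hRop : Rop = ∑ i, b i)
    (hG : HasSum (fun n : ℕ => G₀ * Rop ^ n) G)
    (hab : ∀ i l, ¬ adj i l → a i * b l = 0) (hbb : ∀ i l, ¬ adj i l → b i * b l = 0)
    (hP : ∀ i ∉ S₀, P * a i = 0) (hP'a : ∀ i ∉ S₁, a i * P' = 0) (hP'b : ∀ i ∉ S₁, b i * P' = 0)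
    (hα : ∀ i, ‖P * a i‖ ≤ α) (hβ0 : 0 ≤ β) (hβ : ∀ i, ‖b i‖ ≤ β) (hβ₁ : ∀ i, ‖b i * P'‖ ≤ β₁)
    (hD : ∀ j, (Finset.univ.filter fun i => adj j i).card ≤ D) (hDβ : (D : ℝ) * β < 1) (hN : 1 ≤ N)
    (hsep : ∀ (n : ℕ) (i : ι), i ∈ S₀ → ∀ ys : Fin n → ι, IsWalk adj i ys → lastPt i n ys ∈ S₁ → N ≤ n) :
    ‖P * G * P'‖ ≤ S₀.card * α * β₁ * D * ((D : ℝ) * β) ^ (N - 1) / (1 - D * β) := by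
  obtain ⟨N', rfl⟩ : ∃ N', N = N' + 1 := ⟨N - 1, by omega⟩
  rw [Nat.add_sub_cancel]
  subst hG₀ hRop
  -- (2.12), cut off on both sides
  have hf : HasSum (fun n : ℕ => P * ((∑ i, a i) * (∑ i, b i) ^ n) * P') (P * G * P') :=
    (hG.mul_left P).mul_right P'
  -- the terms of order < N vanish: pass to the tail
  have h0 : ∑ n ∈ Finset.range (N' + 1), P * ((∑ i, a i) * (∑ i, b i) ^ n) * P' = 0 :=
    Finset.sum_eq_zero fun n hn =>
      cut_order_term_eq_zero adj hab hbb hP hP'a hP'b hsep (Finset.mem_range.mp hn)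
  have hf' : HasSum (fun m : ℕ => P * ((∑ i, a i) * (∑ i, b i) ^ (m + (N' + 1))) * P') (P * G * P') := by
    have h := (hasSum_nat_add_iff' (N' + 1)).mpr hf
    rw [h0, sub_zero] at h
    exact h
  -- geometric majorant
  have hr0 : 0 ≤ (D : ℝ) * β := mul_nonneg (Nat.cast_nonneg _) hβ0
  have hg : HasSum (fun m : ℕ => S₀.card * α * β₁ * D * ((D : ℝ) * β) ^ N' * ((D : ℝ) * β) ^ m)
      (S₀.card * α * β₁ * D * ((D : ℝ) * β) ^ N' * (1 - (D : ℝ) * β)⁻¹) :=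
    (hasSum_geometric_of_lt_one hr0 hDβ).mul_left _
  have hbound : ∀ m : ℕ, ‖P * ((∑ i, a i) * (∑ i, b i) ^ (m + (N' + 1))) * P'‖
      ≤ S₀.card * α * β₁ * D * ((D : ℝ) * β) ^ N' * ((D : ℝ) * β) ^ m := fun m => by
    rw [← Nat.add_assoc m N' 1]
    refine (norm_cut_order_term_le adj hab hbb hP hα hβ hβ₁ hD (m + N')).trans (le_of_eq ?_)
    ring
  rw [div_eq_mul_inv]
  exact hf'.norm_le_of_bounded hg hbound

/-- the same bound in EXPONENTIAL form: if `Dβ ≤ e^{−δ}` with `δ > 0` then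
`‖P G P'‖ ≤ |S₀|αβ₁D(1 − e^{−δ})^{−1} · e^{−δ(N−1)}` — the shape `c₀e^{−δ₀dist(supp f, supp f')}` of (2.30)
(with `N − 1 ≥ M^{−1}dist − 3` steps). [cite: Balaban1983RegularityDecay, (2.22) p.579, (2.30) p.580] -/
theorem walk_decay_bound_exp (adj : ι → ι → Prop) [DecidableRel adj]
    {a b : ι → R} {G G₀ Rop P P' : R} {S₀ S₁ : Finset ι} {α β β₁ δ : ℝ} {D N : ℕ}
    (hG₀ : G₀ = ∑ i, a i) (hRop : Rop = ∑ i, b i)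
    (hG : HasSum (fun n : ℕ => G₀ * Rop ^ n) G)
    (hab : ∀ i l, ¬ adj i l → a i * b l = 0) (hbb : ∀ i l, ¬ adj i l → b i * b l = 0)
    (hP : ∀ i ∉ S₀, P * a i = 0) (hP'a : ∀ i ∉ S₁, a i * P' = 0) (hP'b : ∀ i ∉ S₁, b i * P' = 0)
    (hα : ∀ i, ‖P * a i‖ ≤ α) (hβ0 : 0 ≤ β) (hβ : ∀ i, ‖b i‖ ≤ β) (hβ₁ : ∀ i, ‖b i * P'‖ ≤ β₁)
    (hD : ∀ j, (Finset.univ.filter fun i => adj j i).card ≤ D) (hδ : 0 < δ)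
    (hDβ : (D : ℝ) * β ≤ Real.exp (-δ)) (hN : 1 ≤ N)
    (hsep : ∀ (n : ℕ) (i : ι), i ∈ S₀ → ∀ ys : Fin n → ι, IsWalk adj i ys → lastPt i n ys ∈ S₁ → N ≤ n) :
    ‖P * G * P'‖ ≤
      S₀.card * α * β₁ * D / (1 - Real.exp (-δ)) * Real.exp (-(δ * ((N - 1 : ℕ) : ℝ))) := by
  have he1 : Real.exp (-δ) < 1 := Real.exp_lt_one_iff.mpr (neg_lt_zero.mpr hδ)
  have hr0 : 0 ≤ (D : ℝ) * β := mul_nonneg (Nat.cast_nonneg _) hβ0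
  have hDβ1 : (D : ℝ) * β < 1 := hDβ.trans_lt he1
  have h := walk_decay_bound adj hG₀ hRop hG hab hbb hP hP'a hP'b hα hβ0 hβ hβ₁ hD hDβ1 hN hsep
  have hK : 0 ≤ (S₀.card : ℝ) * α * β₁ * D := by
    rcases S₀.eq_empty_or_nonempty with hS | ⟨i, _⟩
    · simp [hS]
    · exact mul_nonneg (mul_nonneg (mul_nonneg (Nat.cast_nonneg _) ((norm_nonneg _).trans (hα i)))
        ((norm_nonneg _).trans (hβ₁ i))) (Nat.cast_nonneg _)
  have hpow : ((D : ℝ) * β) ^ (N - 1) ≤ Real.exp (-(δ * ((N - 1 : ℕ) : ℝ))) := by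
    rw [show -(δ * ((N - 1 : ℕ) : ℝ)) = ((N - 1 : ℕ) : ℝ) * (-δ) by ring, Real.exp_nat_mul]
    exact pow_le_pow_left₀ hr0 hDβ _
  have hinv : (1 - (D : ℝ) * β)⁻¹ ≤ (1 - Real.exp (-δ))⁻¹ :=
    inv_anti₀ (by linarith) (by linarith)
  calc ‖P * G * P'‖ ≤ S₀.card * α * β₁ * D * ((D : ℝ) * β) ^ (N - 1) / (1 - D * β) := h
    _ = S₀.card * α * β₁ * D * (1 - (D : ℝ) * β)⁻¹ * ((D : ℝ) * β) ^ (N - 1) := by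
        rw [div_eq_mul_inv]; ring
    _ ≤ S₀.card * α * β₁ * D * (1 - Real.exp (-δ))⁻¹ * Real.exp (-(δ * ((N - 1 : ℕ) : ℝ))) :=
        mul_le_mul (mul_le_mul_of_nonneg_left hinv hK) hpow (pow_nonneg hr0 _)
          (mul_nonneg hK (inv_nonneg.mpr (by linarith)))
    _ = S₀.card * α * β₁ * D / (1 - Real.exp (-δ)) * Real.exp (-(δ * ((N - 1 : ℕ) : ℝ))) := by
        rw [div_eq_mul_inv]

omit [Fintype ι] [DecidableEq ι] in
/-- **(2.12) FROM SMALLNESS OF `R`** in a complete normed ring: if `‖R‖ < 1` and `G(I − R) = G₀` then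
`G = Σ_{n≥0} G₀Rⁿ` (convergent) — *"the L²-norm of the operator R … is small for M large enough, so the series in
the representation (2.12) is convergent in this norm"*. [cite: Balaban1983RegularityDecay, (2.12) p.577] -/
theorem hasSum_of_norm_lt_one [CompleteSpace R] {G G₀ Rop : R} (hR : ‖Rop‖ < 1) (hG : G * (1 - Rop) = G₀) :
    HasSum (fun n : ℕ => G₀ * Rop ^ n) G := by
  have hs : Summable fun n : ℕ => Rop ^ n := summable_geometric_of_norm_lt_one hR
  have h2 : (1 - Rop) * ∑' n : ℕ, Rop ^ n = 1 := mul_neg_geom_series Rop hR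
  have hGeq : G = G₀ * ∑' n : ℕ, Rop ^ n := by
    rw [← hG, mul_assoc, h2, mul_one]
  rw [hGeq]
  exact hs.hasSum.mul_left G₀

omit [Fintype ι] [DecidableEq ι] in
/-- uniqueness behind `G₀(I − R)^{−1}`: for `‖R‖ < 1`, `I − R` is invertible, so `G(I − R) = G₀` determines `G`.
[folklore] -/
theorem eq_of_mul_one_sub_eq [CompleteSpace R] {G G' G₀ Rop : R} (hR : ‖Rop‖ < 1)
    (hG : G * (1 - Rop) = G₀) (hG' : G' * (1 - Rop) = G₀) : G = G' := by
  have h2 : (1 - Rop) * ∑' n : ℕ, Rop ^ n = 1 := mul_neg_geom_series Rop hR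
  calc G = G * ((1 - Rop) * ∑' n : ℕ, Rop ^ n) := by rw [h2, mul_one]
    _ = G' * ((1 - Rop) * ∑' n : ℕ, Rop ^ n) := by rw [← mul_assoc, hG, ← hG', mul_assoc]
    _ = G' := by rw [h2, mul_one]

end Normed

/-! ### §5 The `ℤ^d` model: unit-cube adjacency, `3^d` successors, displacement, separation -/

section Lattice

variable {ι : Type*} {d : ℕ}

/-- the printed adjacency: `j ~ j'` iff `|j − j'| = max_μ|j_μ − j'_μ| ≤ 1` (*"ω_{i+1} = ω_i + Σ_{μ=1}^{d} ε_μe_μ,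
where ε_μ is one of the numbers −1, 0, 1"*), for labels placed in `ℤ^d` by `pos`. [cite: Balaban1983RegularityDecay, (2.13)
p.577] -/
def cubeAdj (pos : ι → Fin d → ℤ) (i l : ι) : Prop := ∀ μ, |pos i μ - pos l μ| ≤ 1

/-- `cubeAdj` is decidable. [folklore] -/
instance cubeAdj.instDecidableRel (pos : ι → Fin d → ℤ) : DecidableRel (cubeAdj pos) :=
  fun i l => inferInstanceAs (Decidable (∀ μ, |pos i μ - pos l μ| ≤ 1))

/-- the side of the successor cube: `#{x−1, x, x+1} = 3`. [folklore] -/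
theorem card_Icc_pm_one (x : ℤ) : (Finset.Icc (x - 1) (x + 1)).card = 3 := by
  rw [Int.card_Icc, show x + 1 + 1 - (x - 1) = 3 by ring]
  rfl

/-- **`3^d` SUCCESSORS**: with injective labels, a point has at most `3^d` cube-neighbours (itself included) —
the `3^d` of *"2^d(3^d)^{n−1}2^d"*. [cite: Balaban1983RegularityDecay, p.579 before (2.22)] -/
theorem card_cubeAdj_le [Fintype ι] [DecidableEq ι] (pos : ι → Fin d → ℤ) (hpos : Function.Injective pos)
    (i : ι) : (Finset.univ.filter fun l => cubeAdj pos i l).card ≤ 3 ^ d := by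
  set S := Finset.univ.filter fun l => cubeAdj pos i l with hS
  set T : Finset (Fin d → ℤ) := Fintype.piFinset fun μ : Fin d => Finset.Icc (pos i μ - 1) (pos i μ + 1)
    with hT
  have h1 : (S.image pos).card = S.card := Finset.card_image_of_injective S hpos
  have h2 : S.image pos ⊆ T := by
    intro z hz
    obtain ⟨l, hl, rfl⟩ := Finset.mem_image.mp hz
    have hl' : cubeAdj pos i l := (Finset.mem_filter.mp hl).2
    rw [hT, Fintype.mem_piFinset]
    intro μ
    have hμ := hl' μ
    rw [abs_le] at hμ
    rw [Finset.mem_Icc]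
    constructor <;> linarith [hμ.1, hμ.2]
  have h3 : T.card = 3 ^ d := by
    rw [hT, Fintype.card_piFinset]
    rw [Finset.prod_congr rfl fun μ _ => card_Icc_pm_one (pos i μ)]
    simp
  rw [← h1, ← h3]
  exact Finset.card_le_card h2

/-- **DISPLACEMENT**: along a cube-walk of length `n` every coordinate moves by at most `n`. [folklore] -/
theorem walk_displacement (pos : ι → Fin d → ℤ) :
    ∀ (n : ℕ) (j : ι) (ys : Fin n → ι), IsWalk (cubeAdj pos) j ys →
      ∀ μ, |pos j μ - pos (lastPt j n ys) μ| ≤ n := by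
  intro n
  induction n with
  | zero => intro j ys _ μ; simp
  | succ n ih =>
      intro j ys hw μ
      rw [isWalk_succ] at hw
      have h1 : |pos j μ - pos (ys 0) μ| ≤ 1 := hw.1 μ
      have h2 := ih (ys 0) (Fin.tail ys) hw.2 μ
      rw [lastPt_tail] at h2
      calc |pos j μ - pos (lastPt j (n + 1) ys) μ|
          ≤ |pos j μ - pos (ys 0) μ| + |pos (ys 0) μ - pos (lastPt j (n + 1) ys) μ| := abs_sub_le _ _ _
        _ ≤ 1 + (n : ℤ) := add_le_add h1 h2
        _ = ((n + 1 : ℕ) : ℤ) := by push_cast; ring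

/-- **SEPARATION ⇒ LENGTH**: if every point of `S₀` is at sup-distance `≥ N` from every point of `S₁`, then every
cube-walk from `S₀` ending in `S₁` has at least `N` steps — *"the length n satisfies n ≥ M^{−1}dist(…) − 2"*.
[cite: Balaban1983RegularityDecay, p.579 before (2.22)] -/
theorem le_length_of_separated (pos : ι → Fin d → ℤ) {S₀ S₁ : Finset ι} {N : ℕ}
    (hsep : ∀ i ∈ S₀, ∀ l ∈ S₁, ∃ μ, (N : ℤ) ≤ |pos i μ - pos l μ|) :
    ∀ (n : ℕ) (i : ι), i ∈ S₀ → ∀ ys : Fin n → ι, IsWalk (cubeAdj pos) i ys →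
      lastPt i n ys ∈ S₁ → N ≤ n := by
  intro n i hi ys hw hl
  obtain ⟨μ, hμ⟩ := hsep i hi _ hl
  exact_mod_cast hμ.trans (walk_displacement pos n i ys hw μ)

/-- **COROLLARY 2.3 (2.30), ABSTRACT `ℤ^d` FORM**: the decay bound of §4 for the printed cube adjacency, with
`D = 3^d` and the separation expressed by sup-distance `≥ N ≥ 1` between the label sets `S₀ ∋ ω₀` and
`S₁ ∋ ω_n`: `‖P G P'‖ ≤ |S₀|·α·β₁·3^d·(3^dβ)^{N−1}/(1 − 3^dβ)`. All operator-theoretic inputs (the series (2.12),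
locality, the Lemma 2.1-type bounds, `3^dβ < 1`) are hypotheses. [cite: Balaban1983RegularityDecay, (2.13)
p.577, (2.22) p.579, Corollary 2.3 (2.30) pp.580–581] -/
theorem lattice_walk_decay_bound {R : Type*} [NormedRing R] [Fintype ι] [DecidableEq ι]
    (pos : ι → Fin d → ℤ) (hpos : Function.Injective pos)
    {a b : ι → R} {G G₀ Rop P P' : R} {S₀ S₁ : Finset ι} {α β β₁ : ℝ} {N : ℕ}
    (hG₀ : G₀ = ∑ i, a i) (hRop : Rop = ∑ i, b i)
    (hG : HasSum (fun n : ℕ => G₀ * Rop ^ n) G)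
    (hab : ∀ i l, ¬ cubeAdj pos i l → a i * b l = 0) (hbb : ∀ i l, ¬ cubeAdj pos i l → b i * b l = 0)
    (hP : ∀ i ∉ S₀, P * a i = 0) (hP'a : ∀ i ∉ S₁, a i * P' = 0) (hP'b : ∀ i ∉ S₁, b i * P' = 0)
    (hα : ∀ i, ‖P * a i‖ ≤ α) (hβ0 : 0 ≤ β) (hβ : ∀ i, ‖b i‖ ≤ β) (hβ₁ : ∀ i, ‖b i * P'‖ ≤ β₁)
    (h3β : (3 : ℝ) ^ d * β < 1) (hN : 1 ≤ N)
    (hsep : ∀ i ∈ S₀, ∀ l ∈ S₁, ∃ μ, (N : ℤ) ≤ |pos i μ - pos l μ|) :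
    ‖P * G * P'‖ ≤
      S₀.card * α * β₁ * (3 : ℝ) ^ d * ((3 : ℝ) ^ d * β) ^ (N - 1) / (1 - (3 : ℝ) ^ d * β) := by
  have h := walk_decay_bound (cubeAdj pos) hG₀ hRop hG hab hbb hP hP'a hP'b hα hβ0 hβ hβ₁
    (card_cubeAdj_le pos hpos) (D := 3 ^ d) (by exact_mod_cast h3β) hN (le_length_of_separated pos hsep)
  exact_mod_cast h

end Lattice

/-! ### §6 Bounded overlap ⇒ the norm of `R = Σ_j K_jG_k(□_j)h_j` is controlled by ONE summand -/

section Overlap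

variable {𝕜 : Type*} [RCLike 𝕜] {E : Type*} [SeminormedAddCommGroup E] [InnerProductSpace 𝕜 E] {ι : Type*}

open scoped InnerProductSpace

/-- **ALMOST-ORTHOGONALITY** (the step behind p. 577 *"Lemma 2.1 implies that the L²-norm of the operator R given
by (2.11) is small for M large enough"*, uniformly in the number of cubes): if the vectors `u j` (↦ `K_jG_k(□_j)h_jf`)
are pairwise orthogonal except along a symmetric relation `~` (↦ the cubes `□_j`, `□_{j'}` overlap) under which
every index has at most `m` partners in `s` (↦ `m ≤ 3^d`), then `‖Σ_j u j‖² ≤ m·Σ_j ‖u j‖²` (Schur test). With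
`‖u j‖ ≤ τ‖1_{□̃_j}f‖` and `Σ_j ‖1_{□̃_j}f‖² ≤ m̃‖f‖²` this gives `‖R‖ ≤ τ√(m m̃)` = `c₂O(1)M^{−1}`, independent
of `|Ω|`. [cite: Balaban1983RegularityDecay, (2.11)–(2.12) pp.576–577; proof supplied by the audit] -/
theorem norm_sum_sq_le_of_overlap (s : Finset ι) (adj : ι → ι → Prop) [DecidableRel adj]
    (hsymm : ∀ i l, adj i l → adj l i) (u : ι → E)
    (horth : ∀ i ∈ s, ∀ l ∈ s, ¬ adj i l → ⟪u i, u l⟫_𝕜 = 0) {m : ℕ}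
    (hm : ∀ i ∈ s, (s.filter fun l => adj i l).card ≤ m) :
    ‖∑ i ∈ s, u i‖ ^ 2 ≤ m * ∑ i ∈ s, ‖u i‖ ^ 2 := by
  have h1 : ‖∑ i ∈ s, u i‖ ^ 2 = ∑ i ∈ s, ∑ l ∈ s, RCLike.re ⟪u i, u l⟫_𝕜 := by
    rw [@norm_sq_eq_re_inner 𝕜, sum_inner, map_sum]
    exact Finset.sum_congr rfl fun i _ => by rw [inner_sum, map_sum]
  have h2 : ∀ i ∈ s, ∀ l ∈ s, RCLike.re ⟪u i, u l⟫_𝕜 ≤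
      (if adj i l then ‖u i‖ ^ 2 / 2 else 0) + (if adj i l then ‖u l‖ ^ 2 / 2 else 0) := by
    intro i hi l hl
    split_ifs with h
    · have := re_inner_le_norm (𝕜 := 𝕜) (u i) (u l)
      linarith [two_mul_le_add_sq ‖u i‖ ‖u l‖]
    · rw [horth i hi l hl h, map_zero, add_zero]
  have hA : ∀ i ∈ s, ∑ l ∈ s, (if adj i l then ‖u i‖ ^ 2 / 2 else 0) ≤ m * (‖u i‖ ^ 2 / 2) := by
    intro i hi
    rw [← Finset.sum_filter, Finset.sum_const, nsmul_eq_mul]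
    exact mul_le_mul_of_nonneg_right (by exact_mod_cast hm i hi) (by positivity)
  have hB : ∀ l ∈ s, ∑ i ∈ s, (if adj i l then ‖u l‖ ^ 2 / 2 else 0) ≤ m * (‖u l‖ ^ 2 / 2) := by
    intro l hl
    rw [← Finset.sum_filter, Finset.sum_const, nsmul_eq_mul]
    have hfl : (s.filter fun i => adj i l) = s.filter fun i => adj l i :=
      Finset.filter_congr fun i _ => ⟨hsymm i l, hsymm l i⟩
    rw [hfl]
    exact mul_le_mul_of_nonneg_right (by exact_mod_cast hm l hl) (by positivity)
  calc ‖∑ i ∈ s, u i‖ ^ 2 = ∑ i ∈ s, ∑ l ∈ s, RCLike.re ⟪u i, u l⟫_𝕜 := h1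
    _ ≤ ∑ i ∈ s, ∑ l ∈ s,
          ((if adj i l then ‖u i‖ ^ 2 / 2 else 0) + (if adj i l then ‖u l‖ ^ 2 / 2 else 0)) :=
        Finset.sum_le_sum fun i hi => Finset.sum_le_sum fun l hl => h2 i hi l hl
    _ = (∑ i ∈ s, ∑ l ∈ s, if adj i l then ‖u i‖ ^ 2 / 2 else 0)
          + ∑ i ∈ s, ∑ l ∈ s, (if adj i l then ‖u l‖ ^ 2 / 2 else 0) := by
        rw [← Finset.sum_add_distrib]
        exact Finset.sum_congr rfl fun i _ => Finset.sum_add_distrib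
    _ = (∑ i ∈ s, ∑ l ∈ s, if adj i l then ‖u i‖ ^ 2 / 2 else 0)
          + ∑ l ∈ s, ∑ i ∈ s, (if adj i l then ‖u l‖ ^ 2 / 2 else 0) := by
        congr 1
        exact Finset.sum_comm
    _ ≤ (∑ i ∈ s, m * (‖u i‖ ^ 2 / 2)) + ∑ l ∈ s, m * (‖u l‖ ^ 2 / 2) :=
        add_le_add (Finset.sum_le_sum hA) (Finset.sum_le_sum hB)
    _ = m * ∑ i ∈ s, ‖u i‖ ^ 2 := by
        rw [← Finset.mul_sum, ← Finset.sum_div]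
        ring

/-- the companion counting step: for `{0,1}`-valued weights `χ j x` (↦ indicators of the enlarged cubes `□̃_j`)
covering every point at most `m̃` times, `Σ_j Σ_x χ j x · c x ≤ m̃ · Σ_x c x` for nonnegative `c` (↦ `c x = |f(x)|²`,
i.e. `Σ_j ‖1_{□̃_j}f‖² ≤ m̃‖f‖²`). [folklore] -/
theorem sum_overlap_le {X : Type*} (J : Finset ι) (Xs : Finset X) (χ : ι → X → ℕ) (c : X → ℝ)
    (hc : ∀ x ∈ Xs, 0 ≤ c x) {m' : ℕ} (hcover : ∀ x ∈ Xs, ∑ j ∈ J, χ j x ≤ m') :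
    ∑ j ∈ J, ∑ x ∈ Xs, (χ j x : ℝ) * c x ≤ m' * ∑ x ∈ Xs, c x := by
  rw [Finset.sum_comm, Finset.mul_sum]
  refine Finset.sum_le_sum fun x hx => ?_
  rw [← Finset.sum_mul]
  exact mul_le_mul_of_nonneg_right (by exact_mod_cast hcover x hx) (hc x hx)

end Overlap

end Literature.MathematicalPhysics.QuantumFieldTheory.Balaban1983to89.B4RandomWalk213
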